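import Summits.ResolutionOfSingularities.ResolutionOfSingularities.Theorems.ShadeCutTailTwo
import HarnessLib

/-!
# ShadeCutShadeTwo — decomp-res node «ShadeCut» (lens-3 g16), tree file 3/4: §S part 2 — the CONSTANT PHASE
`ConstTwo` (frozen ledger:
every move keeps mass exactly `q − 2`; repeats need three positive coordinates, translations need a zero
coordinate) and **THE SHADE-TWO
THEOREM** `shadeTwo_tail_false`: along a forced walk from a root with `q ≥ 4` no tail is a shade-2 excess plateau
with proximity repeats
AND translated moves both infinitely often.  PROVED, 0 sorry.

Content VERBATIM from the decomp-res lens-3 g16 file `HOME/decomp-res-lens-3/g16/ShadeCut.lean` (sha256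
d031e7e4ff78d2a8…, 1829 l; CRITIC-LEDGER
row 130 CLEARED (DECIDED +1 · MAP +1), landing orders 2026-08-30T18:2xZ (row 130 rider) / 19:49:35Z (row 136:
ShadeCut FIRST, then lens-3 g17
«TightCut» as modules importing these)).  HOME = run/shared/lean/pub/decomp-res.  Host: route `MaxContactCut`,
aside 31770 `DefectWalksDeep`
through the tree's hypothesis-free `ExitLaw.defectWalksDeep_iff_joint'` and the lens-3 g15 node `Theorems/ConeCut*` (landed).

[WRITER NOTE (decomp-res writer g7): per the lens's own DELETE-ON-LANDING markers and critic row 123 h1 / row 130,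
the carried sections §V1
(g15 walk arithmetic = tree `Theorems/FloorCutFloor`), §V2 (g15 §A–§B residual-cone calculus up to the POWER
LAW = tree `Theorems/ConeCutLayers`,
`ConeCutLayersPoint`, `ConeCutWalks`) and §V3 (§AxisLaw = tree `Theorems/ConeCutAxisLaw`) are DELETED and the tree
modules imported/opened
instead (no third copy of the calculus; `exists_ne` is spelled `FloorCut.exists_ne` against Mathlib's root one); the
lens's `exists_third` (≡ tree `ConeCut.exists_third`, implicit binders) and `degree_eq_sum3`
(≡ `Finsupp.degree_eq_sum` + `Fin.sum_univ_three`, as in `FloorCutFloor`) are likewise replaced by the tree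
spellings; §L's VERBATIM g15
classes `IsTameFrom` / `NoMixedTailsDeep` / `NoTameMixedTailsDeep` are the landed `Theorems/ConeCutClasses` ones
(opened, not restated); §M
`closes` (≡ `MaxContactCutExponentLadder.closes`, a by-name re-export) is not restated.  Split: `ShadeCutLawJ`
(§J LAW J) · `ShadeCutTailTwo` /
`ShadeCutShadeTwo` (§S the shade-two theorem, PROVED; `section ShadeTwo` re-opened) · `MaxContactCutShadeCut` (§K
booking BY NAME to 31770 + §L letters).  ONE namespace `…Theorems.ShadeCut` as in the
lens; global `set_option` line dropped; the lens's `fin3_enum` (≡ the landed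
`Literature.RepresentationTheory.GeneralLinear.fin3_cases`,
dedup.landed) deleted: its two uses get a proof-local `have fin3_enum … := by decide`; nothing else changed.]
(Sources: Hauser2010 §§D,F,G; HauserPerlega2019; Moh1987; CossartPiltant2019; CossartJannsenSaito2020 Thm. 2.14,
§§5,9; BenitoVillamayor2013 §7; CasasAlvero2000 Ch. 3.)
-/

noncomputable section

open MvPolynomial Finset
open Literature.AlgebraicGeometry.Resolution
open Literature.AlgebraicGeometry.Resolution.Hauser2010
open Literature.AlgebraicGeometry.Resolution.PointBlowup
open Summit.ResolutionOfSingularities.ResolutionOfSingularities.Theses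
open Summit.ResolutionOfSingularities.ResolutionOfSingularities.Theorems.TightDefectClasses
open Summit.ResolutionOfSingularities.ResolutionOfSingularities.Theorems.TightDefectStrongWalks
open Summit.ResolutionOfSingularities.ResolutionOfSingularities.Theorems.ItineraryCutClasses
open Summit.ResolutionOfSingularities.ResolutionOfSingularities.Theorems.BoundaryLedger
open Summit.ResolutionOfSingularities.ResolutionOfSingularities.Theorems.ProximityCut
open Literature.AlgebraicGeometry.Resolution.WeightedBlowup
open Literature.Barriers.ResolutionOfSingularities
open Summit.ResolutionOfSingularities.ResolutionOfSingularities.Theorems.FloorCut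
open Summit.ResolutionOfSingularities.ResolutionOfSingularities.Theorems.ConeCutAxisLaw
open Summit.ResolutionOfSingularities.ResolutionOfSingularities.Theorems.ConeCut
open Summit.ResolutionOfSingularities.ResolutionOfSingularities.Theorems.ExitLaw (fin3_cases)

namespace Summit.ResolutionOfSingularities.ResolutionOfSingularities.Theorems.ShadeCut

section ShadeTwo

variable {K : Type} [Field K] [DecidableEq K] {q : ℕ} {s₀ : State (Fin 3) K}

/-- The CONSTANT PHASE of a shade-two tail: `TailTwo` from `N`, boundary mass frozen from `T ≥ N + q`.
DEFINITION (support). -/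
structure ConstTwo (W : ForcedWalk q s₀) (N T : ℕ) : Prop where
  tail : TailTwo W N
  le : N + q ≤ T
  const : ∀ t, T ≤ t → (W.st t).r.degree = (W.st T).r.degree

namespace ConstTwo

variable {W : ForcedWalk q s₀} {N T : ℕ}

/-- The frozen ledger: every move of the constant phase keeps mass exactly `q − 2`; newest masses `D + 2 − q`.
[new] [folklore] -/
theorem step (hroot : IsRoot q s₀) (h : ConstTwo W N T) (u : ℕ) (hu : T ≤ u) :
    (kept W (u + 1)).degree + 2 = q ∧
    (W.st (u + 1)).r (W.j u) + q = (W.st T).r.degree + 2 ∧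
    (W.st (u + 2)).r (W.j (u + 1)) + q = (W.st T).r.degree + 2 ∧
    (∀ i, i ≠ W.j (u + 1) → (W.st (u + 2)).r i = kept W (u + 1) i) ∧
    (W.st (u + 1)).r.degree = (W.st T).r.degree ∧
    1 + q ≤ (W.st T).r.degree + 2 ∧ 2 * (W.st T).r.degree + 3 ≤ 3 * q := by
  obtain ⟨hd₁, hch₁, hoff₁⟩ := h.tail.step hroot (u + 1) (by have := h.le; omega)
  rw [show u + 1 + 1 = u + 2 from rfl] at hd₁ hch₁ hoff₁
  obtain ⟨-, hch₀, -⟩ := h.tail.step hroot u (by have := h.le; omega)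
  have e0 := h.const u hu
  have e1 := h.const (u + 1) (by omega)
  have e2 := h.const (u + 2) (by omega)
  have hg := h.tail.degree_window hroot T (by have := h.le; omega)
  have h3 := two_degree_le hroot W T
  exact ⟨by omega, by omega, by omega, hoff₁, e1, by omega, h3⟩

/-- A REPEAT in the constant phase is untranslated, sits on three POSITIVE coordinates `(x, x, q − 2 − x)` and freezes
the boundary vector. [new] [folklore] -/
theorem repeat_move (hroot : IsRoot q s₀) (hq : 4 ≤ q) (h : ConstTwo W N T) (u : ℕ) (hu : T ≤ u)
    (hS : StaysOnNewest W u) {k : Fin 3} (hk₁ : k ≠ W.j (u + 1)) (hk₀ : k ≠ W.j u) :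
    W.b (u + 1) k = 0 ∧ 1 ≤ (W.st (u + 1)).r (W.j u) ∧ 1 ≤ (W.st (u + 1)).r (W.j (u + 1)) ∧
    1 ≤ (W.st (u + 1)).r k ∧ (W.st (u + 2)).r = (W.st (u + 1)).r := by
  classical
  obtain ⟨hkd, hx₀, hx₁, hoff, e1, hg, h3⟩ := h.step hroot u hu
  have hsum := degree_eq_three (kept W (u + 1)) hS.1 hk₁ hk₀
  rw [kept_chart] at hsum
  have hkj := kept_of_ne W (u + 1) (i := W.j u) (Ne.symm hS.1)
  rw [if_pos hS.2] at hkj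
  have hkk := kept_of_ne W (u + 1) (i := k) hk₁
  have hdeg1 := degree_eq_three (W.st (u + 1)).r hS.1 hk₁ hk₀
  have hpair2 := pair_lt hroot W (u + 2) (a := W.j u) (c := W.j (u + 1)) hS.1.symm
  have hr2j0 := hoff (W.j u) (Ne.symm hS.1)
  by_cases hb : W.b (u + 1) k = 0
  · rw [if_pos hb] at hkk
    have hpair1 := pair_lt hroot W (u + 1) (a := W.j u) (c := W.j (u + 1)) hS.1.symm
    have hr2k := hoff k hk₁
    refine ⟨hb, by omega, by omega, by omega, ?_⟩
    ext l
    rcases fin3_cases hS.1 hk₁ hk₀ l with hl | hl | hl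
    · rw [hl]
      omega
    · rw [hl, hr2j0, hkj]
    · rw [hl, hr2k, hkk]
  · rw [if_neg hb] at hkk
    exfalso
    omega

/-- A SAME-CHART move in the constant phase translates only along mass-zero coordinates (ghosts) and freezes the
boundary vector. [new] [folklore] -/
theorem same_move (hroot : IsRoot q s₀) (h : ConstTwo W N T) (u : ℕ) (hu : T ≤ u)
    (hj : W.j (u + 1) = W.j u) :
    (∀ l, W.b (u + 1) l ≠ 0 → (W.st (u + 1)).r l = 0) ∧ (W.st (u + 2)).r = (W.st (u + 1)).r := by
  classical
  obtain ⟨hkd, hx₀, hx₁, hoff, e1, hg, h3⟩ := h.step hroot u hu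
  obtain ⟨a, ha⟩ := FloorCut.exists_ne (W.j (u + 1))
  obtain ⟨c, hca, hcj⟩ := exists_third ha
  have hsum := degree_eq_three (kept W (u + 1)) ha hca hcj
  rw [kept_chart] at hsum
  have hka := kept_of_ne W (u + 1) (i := a) ha
  have hkc := kept_of_ne W (u + 1) (i := c) hcj
  have hla := kept_le W (u + 1) a
  have hlc := kept_le W (u + 1) c
  have hdeg1 := degree_eq_three (W.st (u + 1)).r ha hca hcj
  have hx₀' : (W.st (u + 1)).r (W.j (u + 1)) + q = (W.st T).r.degree + 2 := by rw [hj]; exact hx₀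
  have hra := hoff a ha
  have hrc := hoff c hcj
  have hfa : kept W (u + 1) a = (W.st (u + 1)).r a := by omega
  have hfc : kept W (u + 1) c = (W.st (u + 1)).r c := by omega
  refine ⟨fun l hl => ?_, ?_⟩
  · have hlj : l ≠ W.j (u + 1) := by
      intro h'
      rw [h', W.onExc] at hl
      exact hl rfl
    rcases fin3_cases (Ne.symm ha) hcj hca l with h' | h' | h'
    · exact absurd h' hlj
    · rw [h'] at hl ⊢
      rw [if_neg hl] at hka
      omega
    · rw [h'] at hl ⊢
      rw [if_neg hl] at hkc
      omega
  · ext l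
    rcases fin3_cases (Ne.symm ha) hcj hca l with h' | h' | h'
    · rw [h']
      omega
    · rw [h', hra, hfa]
    · rw [h', hrc, hfc]

/-- A CHART-CHANGE F-MOVE (leaving the newest component by translation) in the constant phase starts from a zero
coordinate (the new chart's) and ends on one (the old newest's). [new] [folklore] -/
theorem change_move (hroot : IsRoot q s₀) (h : ConstTwo W N T) (u : ℕ) (hu : T ≤ u)
    (hj : W.j (u + 1) ≠ W.j u) (hb : W.b (u + 1) (W.j u) ≠ 0) :
    (W.st (u + 1)).r (W.j (u + 1)) = 0 ∧ (W.st (u + 2)).r (W.j u) = 0 := by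
  classical
  obtain ⟨hkd, hx₀, hx₁, hoff, e1, hg, h3⟩ := h.step hroot u hu
  obtain ⟨k, hk₁, hk₀⟩ := exists_third hj
  have hsum := degree_eq_three (kept W (u + 1)) hj hk₁ hk₀
  rw [kept_chart] at hsum
  have hkj := kept_of_ne W (u + 1) (i := W.j u) (Ne.symm hj)
  rw [if_neg hb] at hkj
  have hlk := kept_le W (u + 1) k
  have hdeg1 := degree_eq_three (W.st (u + 1)).r hj hk₁ hk₀
  have hpair := pair_lt hroot W (u + 1) (a := W.j u) (c := k) hk₀.symm
  refine ⟨by omega, ?_⟩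
  rw [hoff (W.j u) (Ne.symm hj), hkj]

/-- **THE INVARIANT.**  In the constant phase «the boundary vector has a zero coordinate» is preserved by every move,
is FALSE in front of a repeat and TRUE in front of a translated move. [new] [folklore] -/
theorem zero_step (hroot : IsRoot q s₀) (hq : 4 ≤ q) (h : ConstTwo W N T) (u : ℕ) (hu : T ≤ u) :
    (HasZero W (u + 2) ↔ HasZero W (u + 1)) ∧ (StaysOnNewest W u → ¬ HasZero W (u + 1)) ∧
    (W.b (u + 1) ≠ 0 → HasZero W (u + 1)) := by
  classical
  by_cases hj : W.j (u + 1) = W.j u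
  · obtain ⟨hgh, hr⟩ := h.same_move hroot u hu hj
    refine ⟨by unfold HasZero; rw [hr], fun hS => absurd hj hS.1, fun hb => ?_⟩
    obtain ⟨l, hl⟩ := Function.ne_iff.mp hb
    exact ⟨l, hgh l hl⟩
  · by_cases hb : W.b (u + 1) (W.j u) = 0
    · have hS : StaysOnNewest W u := ⟨hj, hb⟩
      obtain ⟨k, hk₁, hk₀⟩ := exists_third hj
      obtain ⟨hbk, h0, h1, hk, hr⟩ := h.repeat_move hroot hq u hu hS hk₁ hk₀
      have hnz : ¬ HasZero W (u + 1) := by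
        rintro ⟨l, hl⟩
        rcases fin3_cases hj hk₁ hk₀ l with h' | h' | h' <;> rw [h'] at hl <;> omega
      refine ⟨by unfold HasZero; rw [hr], fun _ => hnz, fun hb' => ?_⟩
      exfalso
      obtain ⟨l, hl⟩ := Function.ne_iff.mp hb'
      rcases fin3_cases hj hk₁ hk₀ l with h' | h' | h' <;> rw [h'] at hl
      · exact hl (W.onExc (u + 1))
      · exact hl hb
      · exact hl hbk
    · obtain ⟨h1, h2⟩ := h.change_move hroot u hu hj hb
      exact ⟨⟨fun _ => ⟨_, h1⟩, fun _ => ⟨_, h2⟩⟩, fun hS => absurd hS.2 hb, fun _ => ⟨_, h1⟩⟩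

end ConstTwo

/-- **THE SHADE-TWO THEOREM (PROVED).**  Along a forced walk from a root with `q ≥ 4`, no tail is a shade-2 excess
plateau (shade `≡ 2`, order `≠ q` at every late time) with proximity repeats infinitely often AND translated moves
infinitely often. [new] [folklore] -/
theorem shadeTwo_tail_false (hroot : IsRoot q s₀) (hq : 4 ≤ q) {W : ForcedWalk q s₀} {N : ℕ} (h : TailTwo W N)
    (hR : ∀ M : ℕ, ∃ t, M ≤ t ∧ StaysOnNewest W t) (hT : ∀ M : ℕ, ∃ t, M ≤ t ∧ W.b t ≠ 0) : False := by
  classical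
  obtain ⟨T, hT₀, hconst⟩ := h.eventually_const hroot hq
  have hC : ConstTwo W N T := ⟨h, hT₀, hconst⟩
  have hprop : ∀ t, T + 1 ≤ t → (HasZero W t ↔ HasZero W (T + 1)) := by
    intro t ht
    induction t, ht using Nat.le_induction with
    | base => exact Iff.rfl
    | succ t ht ih =>
      obtain ⟨u, rfl⟩ : ∃ u, t = u + 1 := ⟨t - 1, by omega⟩
      exact (hC.zero_step hroot hq u (by omega)).1.trans ih
  by_cases hz : HasZero W (T + 1)
  · obtain ⟨t, ht, hS⟩ := hR (T + 1)
    have h1 := (hC.zero_step hroot hq t (by omega)).2.1 hS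
    exact h1 ((hprop (t + 1) (by omega)).mpr hz)
  · obtain ⟨t, ht, hb⟩ := hT (T + 2)
    obtain ⟨u, rfl⟩ : ∃ u, t = u + 1 := ⟨t - 1, by omega⟩
    have h1 := (hC.zero_step hroot hq u (by omega)).2.2 hb
    exact hz ((hprop (u + 1) (by omega)).mp h1)

end ShadeTwo

end Summit.ResolutionOfSingularities.ResolutionOfSingularities.Theorems.ShadeCut
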